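import Summits.ResolutionOfSingularities.ResolutionOfSingularities.Theorems.EquisingularLiftEquisingularLiftNatGEPrincipalIdeals
import HarnessLib

/-!
# [OURS · L1 W4.5(b) · EL♮(3) · F-88 phase 3, brick U♭] UNIQUENESS of the algebraization of a closed formal subscheme along a
# PRINCIPAL ideal of definition: `K' + (α)ⁿ⁺¹ = K'' + (α)ⁿ⁺¹` for all `n` ⟹ `K' = K''` (`X` proper over a noetherian `(a)`-complete `A`)

Crux chain w45b (cell `res-hironaka`, slot W4.5(b)), working crux **EL♮** = stmt-ResolutionOfSingularities-20038, child **EL♮(3)** =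
stmt-ResolutionOfSingularities-20148, route EquisingularLift, line `sections`. Written by res-type-027 g23 after E♭ (✓ `…NatGEPrincipalThickenings`,
`GEPrincipal.grothendieckExistence_principal`): phase 3 = F-88 for a GENERAL ideal of definition by induction on generators (res-inputs-crit-1
R186: «the principal brick must be E♭ ∧ U♭»); this file is U♭. HONEST FRAMING: OURS glue around the tree's kernel theorem GW II Cor. 24.100
(`Morphisms/FormalModuleHomCoh.existsUnique_cmplMap_coh`, `cmplMap_injective_coh`); nothing of H. Hironaka's 2017 manuscript is involved or
attributed; AI-written, gate-checked, weaker than expert review. No `sorry`; standard axioms; auxiliary data `quotCokernelIso`, `cmplCompare`,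
`cmplCompareHom` (constructions, not `Prop`s). `--supports stmt-ResolutionOfSingularities-20148 --as helper`.

RESULTS (namespace `…Sections.GEPrincipal`; `α := algebraMapΓ f a`, `powIdeal α n = (α)ⁿ⁺¹`).
* `idealSheaf_eq_of_forall_sup_powIdeal_eq f a K' K'' (h : ∀ n, K' ⊔ powIdeal α n = K'' ⊔ powIdeal α n) : K' = K''`;
* `existsUnique_idealSheaf_forall_eq_sup f a K hK : ∃! K', ∀ n, K n = K' ⊔ powIdeal α n` (existence = brick 2
  `exists_idealSheaf_forall_eq_sup`).
WHY PROPERNESS: on `𝔸¹_{ℤ_p}` the ideals `(1 - px)` and `(1)` have the same reductions modulo every `pⁿ⁺¹`.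

PROOF. `F' := 𝒪_X/K'`, `F'' := 𝒪_X/K''` are coherent; `F'/αⁿ⁺¹F' ≅ 𝒪_X/(K' + (α)ⁿ⁺¹) = 𝒪_X/(K'' + (α)ⁿ⁺¹) ≅ F''/αⁿ⁺¹F''`
(`quotCokernelIso`, universal properties of `idealQuot`/`cokernel`) compatibly with the transitions (`cmplCompareHom`, a morphism of the
completion towers UNDER the completion of `𝒪_X`); by full faithfulness it is `cmplMap φ` for a `φ : F' → F''`, and by faithfulness
`(𝒪_X ↠ F') ≫ φ = (𝒪_X ↠ F'')`, so `K' ≤ K''` on every affine open; symmetrically `K'' ≤ K'`.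

References (method / index only): EGA III₁ (1961) 5.1.4; Görtz–Wedhorn II (2023) Cor. 24.100, Prop. 24.109; Stacks 087W.
-/

set_option linter.dupNamespace false -- mandated namespace `Summit.<Summit>.<Problem>` of this single-conjunct summit

noncomputable section

-- `TopCat.Presheaf`/`Scheme.Modules` are not reducible (as in Mathlib's `AlgebraicGeometry/Modules`).
set_option backward.isDefEq.respectTransparency false

open CategoryTheory CategoryTheory.Limits AlgebraicGeometry TopologicalSpace Opposite
open Literature.AlgebraicGeometry.Modules Literature.AlgebraicGeometry.Morphisms

universe u

namespace Summit.ResolutionOfSingularities.ResolutionOfSingularities.Cruxes.EquisingularLiftNat.Sections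

namespace GEPrincipal

variable {X : Scheme.{u}}

/-! ### `(𝒪_X/L)/αⁿ⁺¹ ≅ 𝒪_X/M` for `M = L + (α)ⁿ⁺¹` -/

section QuotIso

variable (α : Γ(X, ⊤)) (L M : X.IdealSheafData) (n : ℕ) (h : M = L ⊔ powIdeal α n)

include h in
/-- `L` kills `𝒪_X/M`. [folklore] -/
theorem isKilledBy_quot_of_eq_sup : IsKilledBy L (idealQuot (unitModule X) M) :=
  (isKilledBy_idealQuot _ M).anti (h ▸ le_sup_left)

include h in
/-- `αⁿ⁺¹` kills `𝒪_X/M`. [folklore] -/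
theorem globalScalar_quot_eq_zero_of_eq_sup : globalScalar (idealQuot (unitModule X) M) (α ^ (n + 1)) = 0 :=
  globalScalar_eq_zero_of_isKilledBy_pow_ofIdealTop α ((isKilledBy_idealQuot _ M).anti (h ▸ le_sup_right))

include h in
/-- `M` kills `(𝒪_X/L)/αⁿ⁺¹`. [folklore] -/
theorem isKilledBy_cokernel_of_eq_sup :
    IsKilledBy M (cokernel (globalScalar (idealQuot (unitModule X) L) (α ^ (n + 1)))) := by
  rw [h]
  exact IsKilledBy.sup ((isKilledBy_idealQuot _ L).of_epi (cokernel.π _))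
    (isKilledBy_pow_ofIdealTop_of_globalScalar_eq_zero α (globalScalar_cmplObj_eq_zero α _ n))

/-- **`(𝒪_X/L)/αⁿ⁺¹ ≅ 𝒪_X/M` when `M = L + (α)ⁿ⁺¹`** (both are quotients of `𝒪_X` by `M`). [folklore] -/
def quotCokernelIso : cokernel (globalScalar (idealQuot (unitModule X) L) (α ^ (n + 1))) ≅ idealQuot (unitModule X) M where
  hom := cokernel.desc _ (idealQuotDesc (isKilledBy_quot_of_eq_sup α L M n h) (idealQuotπ _ M)) (by
    rw [globalScalar_comp, globalScalar_quot_eq_zero_of_eq_sup α L M n h, comp_zero])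
  inv := idealQuotDesc (isKilledBy_cokernel_of_eq_sup α L M n h) (idealQuotπ _ L ≫ cokernel.π _)
  hom_inv_id := by
    refine coequalizer.hom_ext ?_
    rw [cokernel.π_desc_assoc, Category.comp_id]
    refine idealQuot_hom_ext ?_
    rw [← Category.assoc, idealQuotπ_desc, idealQuotπ_desc]
  inv_hom_id := by
    refine idealQuot_hom_ext ?_
    rw [← Category.assoc, idealQuotπ_desc, Category.assoc, cokernel.π_desc, idealQuotπ_desc, Category.comp_id]

/-- The defining property of `quotCokernelIso`: `𝒪_X → 𝒪_X/L → (𝒪_X/L)/αⁿ⁺¹ ≅ 𝒪_X/M` is `𝒪_X → 𝒪_X/M`. [folklore] -/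
@[reassoc]
theorem idealQuotπ_cmplπ_quotCokernelIso_hom :
    idealQuotπ (unitModule X) L ≫ cmplπ α (idealQuot (unitModule X) L) n ≫ (quotCokernelIso α L M n h).hom =
      idealQuotπ (unitModule X) M := by
  change idealQuotπ (unitModule X) L ≫ cokernel.π _ ≫ cokernel.desc _ _ _ = _
  rw [cokernel.π_desc, idealQuotπ_desc]

/-- … equivalently `𝒪_X → 𝒪_X/M ≅ (𝒪_X/L)/αⁿ⁺¹` is `𝒪_X → 𝒪_X/L → (𝒪_X/L)/αⁿ⁺¹`. [folklore] -/
@[reassoc]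
theorem idealQuotπ_quotCokernelIso_inv :
    idealQuotπ (unitModule X) M ≫ (quotCokernelIso α L M n h).inv =
      idealQuotπ (unitModule X) L ≫ cmplπ α (idealQuot (unitModule X) L) n := by
  rw [← idealQuotπ_cmplπ_quotCokernelIso_hom α L M n h, Category.assoc, Category.assoc, Iso.hom_inv_id,
    Category.comp_id]

end QuotIso

/-! ### The comparison of two completions `(𝒪_X/K')/αⁿ⁺¹ → (𝒪_X/K'')/αⁿ⁺¹` -/

section Compare

variable (α : Γ(X, ⊤)) (K' K'' : X.IdealSheafData)

/-- The comparison `(𝒪_X/K')/αⁿ⁺¹ ≅ 𝒪_X/(K' + (α)ⁿ⁺¹) = 𝒪_X/(K'' + (α)ⁿ⁺¹) ≅ (𝒪_X/K'')/αⁿ⁺¹`. [folklore] -/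
def cmplCompare (n : ℕ) (h : K' ⊔ powIdeal α n = K'' ⊔ powIdeal α n) :
    cmplObj α (idealQuot (unitModule X) K') n ⟶ cmplObj α (idealQuot (unitModule X) K'') n :=
  (quotCokernelIso α K' _ n rfl).hom ≫ (quotCokernelIso α K'' _ n h).inv

/-- The comparison is compatible with the quotient maps from `𝒪_X`. [folklore] -/
@[reassoc]
theorem idealQuotπ_cmplπ_cmplCompare (n : ℕ) (h : K' ⊔ powIdeal α n = K'' ⊔ powIdeal α n) :
    idealQuotπ (unitModule X) K' ≫ cmplπ α _ n ≫ cmplCompare α K' K'' n h =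
      idealQuotπ (unitModule X) K'' ≫ cmplπ α _ n := by
  rw [cmplCompare, idealQuotπ_cmplπ_quotCokernelIso_hom_assoc, idealQuotπ_quotCokernelIso_inv]

/-- The comparisons commute with the transition maps. [folklore] -/
theorem cmplStep_cmplCompare (h : ∀ n, K' ⊔ powIdeal α n = K'' ⊔ powIdeal α n) (n : ℕ) :
    cmplStep α (idealQuot (unitModule X) K') n ≫ cmplCompare α K' K'' n (h n) =
      cmplCompare α K' K'' (n + 1) (h (n + 1)) ≫ cmplStep α (idealQuot (unitModule X) K'') n := by
  haveI : Epi (idealQuotπ (unitModule X) K' ≫ cmplπ α (idealQuot (unitModule X) K') (n + 1)) := epi_comp _ _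
  rw [← cancel_epi (idealQuotπ (unitModule X) K' ≫ cmplπ α (idealQuot (unitModule X) K') (n + 1))]
  simp only [Category.assoc]
  rw [cmplπ_cmplStep_assoc, idealQuotπ_cmplπ_cmplCompare, idealQuotπ_cmplπ_cmplCompare_assoc, cmplπ_cmplStep]

/-- The comparison as a morphism of towers. [folklore] -/
def cmplCompareHom (h : ∀ n, K' ⊔ powIdeal α n = K'' ⊔ powIdeal α n) :
    cmplTower α (idealQuot (unitModule X) K') ⟶ cmplTower α (idealQuot (unitModule X) K'') :=
  NatTrans.ofOpSequence (fun n => cmplCompare α K' K'' n (h n)) fun n => by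
    change towerπ (cmplTower α _) n ≫ _ = _ ≫ towerπ (cmplTower α _) n
    rw [towerπ_cmplTower, towerπ_cmplTower]
    exact cmplStep_cmplCompare α K' K'' h n

/-- Components of the comparison of towers. [folklore] -/
theorem cmplCompareHom_app (h : ∀ n, K' ⊔ powIdeal α n = K'' ⊔ powIdeal α n) (n : ℕ) :
    (cmplCompareHom α K' K'' h).app ⟨n⟩ = cmplCompare α K' K'' n (h n) :=
  rfl

end Compare

/-! ### Uniqueness -/

section Unique

variable {A : Type u} [CommRing A] [IsNoetherianRing A] (f : X ⟶ Spec (.of A)) [IsProper f]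
  (a : A) [IsAdicComplete (Ideal.span {a}) A]

/-- **Uniqueness of the algebraization (principal ideal of definition)**: if two quasi-coherent ideal sheaves `K'`, `K''`
on `X` proper over the noetherian `(a)`-complete `A` have `K' + (α)ⁿ⁺¹ = K'' + (α)ⁿ⁺¹` for all `n` (`α = f♯a`), then
`K' ≤ K''` (hence `=`): `V(K')` and `V(K'')` have the same formal completion along `V(α)`; the completion functor being
fully faithful on coherent modules (GW II Cor. 24.100), the identification of the completions of `𝒪_X/K'` and `𝒪_X/K''`
UNDER `𝒪_X` is `cmplMap φ` for a `φ : 𝒪_X/K' → 𝒪_X/K''` under `𝒪_X` (faithfulness), whence `K' ≤ K''`.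
[cite: GortzWedhorn2023, Cor. 24.100 (p. 568) and Prop. 24.109 (p. 577)] -/
theorem idealSheaf_le_of_forall_sup_powIdeal_eq (K' K'' : X.IdealSheafData)
    (h : ∀ n, K' ⊔ powIdeal (algebraMapΓ f a) n = K'' ⊔ powIdeal (algebraMapΓ f a) n) : K' ≤ K'' := by
  haveI : IsLocallyNoetherian X := LocallyOfFiniteType.isLocallyNoetherian f
  have hF' : Coh (idealQuot (unitModule X) K') := coh_idealQuot K' coh_unit
  have hF'' : Coh (idealQuot (unitModule X) K'') := coh_idealQuot K'' coh_unit
  -- full faithfulness: the comparison of towers is `cmplMap φ`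
  obtain ⟨φ, hφ, -⟩ := existsUnique_cmplMap_coh f a hF' hF'' (cmplCompareHom (algebraMapΓ f a) K' K'' h)
  -- faithfulness: `𝒪_X → 𝒪_X/K' → 𝒪_X/K''` is the quotient map
  have hq : idealQuotπ (unitModule X) K' ≫ φ = idealQuotπ (unitModule X) K'' := by
    refine cmplMap_injective_coh f a coh_unit hF'' ?_
    rw [cmplMap_comp, hφ]
    refine NatTrans.ext (funext fun n => ?_)
    obtain ⟨n⟩ := n
    rw [NatTrans.comp_app, cmplMap_app, cmplMap_app, cmplCompareHom_app,
      ← cancel_epi (cmplπ (algebraMapΓ f a) (unitModule X) n), cmplπ_cmplMapApp_assoc,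
      idealQuotπ_cmplπ_cmplCompare, cmplπ_cmplMapApp]
  -- read off on affine opens
  refine Scheme.IdealSheafData.le_def.mpr fun V r hr => ?_
  rw [mem_ideal_iff_idealQuotπ_app_eq_zero] at hr ⊢
  rw [← hq, Scheme.Modules.Hom.comp_app]
  change φ.app V ((idealQuotπ (unitModule X) K').app V (show Γ(unitModule X, V) from r)) = 0
  rw [hr, map_zero]

/-- **Uniqueness of the algebraization**: `K' + (α)ⁿ⁺¹ = K'' + (α)ⁿ⁺¹` for all `n` implies `K' = K''`.
[cite: GortzWedhorn2023, Cor. 24.100 (p. 568) and Prop. 24.109 (p. 577)] -/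
theorem idealSheaf_eq_of_forall_sup_powIdeal_eq (K' K'' : X.IdealSheafData)
    (h : ∀ n, K' ⊔ powIdeal (algebraMapΓ f a) n = K'' ⊔ powIdeal (algebraMapΓ f a) n) : K' = K'' :=
  le_antisymm (idealSheaf_le_of_forall_sup_powIdeal_eq f a K' K'' h)
    (idealSheaf_le_of_forall_sup_powIdeal_eq f a K'' K' fun n => (h n).symm)

/-- **Existence and uniqueness** of the algebraizing ideal sheaf for a principal ideal of definition (brick 2 + this file).
[cite: GortzWedhorn2023, Prop. 24.109 (p. 577)] -/
theorem existsUnique_idealSheaf_forall_eq_sup (K : ℕ → X.IdealSheafData)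
    (hK : ∀ n, K n = K (n + 1) ⊔ powIdeal (algebraMapΓ f a) n) :
    ∃! K' : X.IdealSheafData, ∀ n, K n = K' ⊔ powIdeal (algebraMapΓ f a) n := by
  obtain ⟨K', hK'⟩ := exists_idealSheaf_forall_eq_sup f a K hK
  exact ⟨K', hK', fun K'' hK'' => idealSheaf_eq_of_forall_sup_powIdeal_eq f a K'' K' fun n => by
    rw [← hK'' n, hK' n]⟩

end Unique

end GEPrincipal

end Summit.ResolutionOfSingularities.ResolutionOfSingularities.Cruxes.EquisingularLiftNat.Sections

end
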